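import Summits.Ventures.PercRepro.C041RcPortDefs

/-!
# THEOREM R, the rc reduction: the zone port problem `rcPort` of a bare colouring (p6, gen 24)

Setting of `C041RcPortDefs`.  `rcPort hc hca hcb O : ZonePort.Problem V (TE a b c O)` — the graph is the red bare
adjacency of `O`, the root set `{c}`, the zones are the port zones of the port vertices, the terminal-edge names are
the terminal edges at the port vertices (`TermEdge`, the subtype `TE`), `tv` = the port vertex of the edge (`tvOf`),
`ts` = «the edge is at `b`», `tz` = the port zone of `tv`, `sw C` = «`C` contains a switchable vertex».  Facts:
`mem_Z_iff`, `tvOf_eq`, `joins_tvOf`, `tvOf_mem_bareReach`, the terms are all of `TE` (`tz_mem_Z`), `ts_true_iff` /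
`ts_false_iff`, `sw_true_iff`, `PV_subset_bareReach`, and `rcPort_zonesReached` (every port zone contains its port
vertex, reached from `c` in `K`) — the connectivity hypothesis of THE LEMMA.
-/

namespace PercRepro

namespace MultiGraph

open Finset ZonePort

variable {V E : Type*} {G : MultiGraph V E}

section Port

variable [Fintype V] (a b c : V) (O : Config E)

/-- A terminal edge at a port vertex. -/
def TermEdge (G : MultiGraph V E) (a b c : V) (O : Config E) (e : E) : Prop :=
  ∃ v, G.IsPortVert a b c O v ∧ (G.Joins e v a ∨ G.Joins e v b)

/-- The terminal edges at the port vertices, as a type. -/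
abbrev TE (G : MultiGraph V E) (a b c : V) (O : Config E) : Type _ := {e : E // G.TermEdge a b c O e}

/-- The non-terminal end of an edge with exactly one terminal end. -/
noncomputable def tvOf (G : MultiGraph V E) (a b : V) (e : E) : V :=
  open Classical in if G.fst e = a ∨ G.fst e = b then G.snd e else G.fst e

omit [Fintype V] in
/-- The non-terminal end of a terminal edge at a non-terminal `v` is `v`. -/
theorem tvOf_eq {v : V} (hv : v ≠ a ∧ v ≠ b) {e : E} (h : G.Joins e v a ∨ G.Joins e v b) : G.tvOf a b e = v := by
  unfold tvOf
  rcases h with (⟨h1, h2⟩ | ⟨h1, h2⟩) | (⟨h1, h2⟩ | ⟨h1, h2⟩)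
  · rw [if_neg (by rw [h1]; exact fun h => h.elim hv.1 hv.2)]
    exact h1
  · rw [if_pos (Or.inl h1)]
    exact h2
  · rw [if_neg (by rw [h1]; exact fun h => h.elim hv.1 hv.2)]
    exact h1
  · rw [if_pos (Or.inr h1)]
    exact h2

variable (hca : c ≠ a) (hcb : c ≠ b)

omit [Fintype V] in
include hca hcb in
/-- A port vertex is not a terminal. -/
theorem portVert_ne_terminal {v : V} (hv : G.IsPortVert a b c O v) : v ≠ a ∧ v ≠ b :=
  bareReach_ne_terminal hca hcb O hv.1

omit [Fintype V] in
include hca hcb in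
/-- The non-terminal end of a terminal edge at a port vertex is that port vertex. -/
theorem tvOf_eq_of_portVert {v : V} (hv : G.IsPortVert a b c O v) {e : E}
    (h : G.Joins e v a ∨ G.Joins e v b) : G.tvOf a b e = v :=
  tvOf_eq a b (portVert_ne_terminal a b c O hca hcb hv) h

omit [Fintype V] in
include hca hcb in
/-- The non-terminal end of a terminal edge at a port vertex is a port vertex carrying it. -/
theorem portVert_tvOf (e : G.TE a b c O) :
    G.IsPortVert a b c O (G.tvOf a b e.1) ∧ (G.Joins e.1 (G.tvOf a b e.1) a ∨ G.Joins e.1 (G.tvOf a b e.1) b) := by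
  obtain ⟨v, hv, h⟩ := e.2
  rw [tvOf_eq_of_portVert a b c O hca hcb hv h]
  exact ⟨hv, h⟩

omit [Fintype V] in
include hca hcb in
/-- The port vertex of a terminal edge lies in `K`. -/
theorem tvOf_mem_bareReach (e : G.TE a b c O) : G.tvOf a b e.1 ∈ G.BareReach a b c O :=
  (portVert_tvOf a b c O hca hcb e).1.1

variable (hc : ∀ e, ¬ G.Joins e c a ∧ ¬ G.Joins e c b)

omit [Fintype V] in
include hc in
/-- The probe is not a port vertex. -/
theorem not_portVert_c : ¬ G.IsPortVert a b c O c := by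
  rintro ⟨_, e, h | h⟩
  · exact (hc e).1 h
  · exact (hc e).2 h

include hc in
/-- The probe lies in no port zone of a port vertex. -/
theorem c_not_mem_portZone {v : V} (hv : G.IsPortVert a b c O v) : c ∉ G.portZone a b c O v := by
  intro h
  by_cases hs : G.Switchable a b c O v
  · rw [portZone_of_switchable a b c O hs, mem_zone] at h
    exact hs.2 h.symm
  · rw [portZone_of_not_switchable a b c O hs, Finset.mem_singleton] at h
    exact not_portVert_c a b c O hc (h ▸ hv)

open Classical in
/-- **The zone port problem of a bare colouring** (C-041.md §3, family `𝒮_rc(O)`). -/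
noncomputable def rcPort : ZonePort.Problem V (G.TE a b c O) where
  adj := G.BareAdj a b O
  symm _ _ h := h.symm
  root := {c}
  Z := (univ.filter fun v => G.IsPortVert a b c O v).image (G.portZone a b c O)
  hdisj C hC D hD hne := by
    rw [mem_image] at hC hD
    obtain ⟨v, _, rfl⟩ := hC
    obtain ⟨w, _, rfl⟩ := hD
    rcases portZone_eq_or_disjoint a b c O v w with h | h
    · exact absurd h hne
    · exact h
  hroot C hC v hv hvr := by
    rw [mem_image] at hC
    obtain ⟨w, hw, rfl⟩ := hC
    rw [mem_filter] at hw
    rw [Finset.mem_singleton] at hvr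
    exact c_not_mem_portZone a b c O hc hw.2 (hvr ▸ hv)
  hzconn C hC := by
    rw [mem_image] at hC
    obtain ⟨w, _, rfl⟩ := hC
    exact portZone_conn a b c O w
  tv e := G.tvOf a b e.1
  ts e := decide (G.EdgeAt e.1 b)
  tz e := G.portZone a b c O (G.tvOf a b e.1)
  htv e := self_mem_portZone a b c O _
  sw C := decide (∃ v ∈ C, G.Switchable a b c O v)
  hk C hC := by
    rw [mem_image] at hC
    obtain ⟨w, hw, rfl⟩ := hC
    rw [mem_filter] at hw
    obtain ⟨e, he⟩ := hw.2.2
    refine ⟨⟨e, w, hw.2, he⟩, ?_⟩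
    show G.portZone a b c O (G.tvOf a b e) = G.portZone a b c O w
    rw [tvOf_eq_of_portVert a b c O hca hcb hw.2 he]

variable {a b c O}

/-- Membership in the zone set. -/
theorem mem_rcPort_Z_iff {C : Finset V} :
    C ∈ (G.rcPort a b c O hca hcb hc).Z ↔ ∃ v, G.IsPortVert a b c O v ∧ G.portZone a b c O v = C := by
  unfold rcPort
  simp only [mem_image, mem_filter, mem_univ, true_and]

/-- The port zone of the end of a terminal edge is a zone. -/
theorem tz_mem_Z (e : G.TE a b c O) : (G.rcPort a b c O hca hcb hc).tz e ∈ (G.rcPort a b c O hca hcb hc).Z :=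
  (mem_rcPort_Z_iff hca hcb hc).2 ⟨G.tvOf a b e.1, (portVert_tvOf a b c O hca hcb e).1, rfl⟩

/-- Every terminal edge at a port vertex is a term. -/
def toTerm (e : G.TE a b c O) : (G.rcPort a b c O hca hcb hc).Term := ⟨e, tz_mem_Z hca hcb hc e⟩

/-- The edge of the term of a terminal edge. -/
@[simp] theorem toTerm_val (e : G.TE a b c O) : (toTerm hca hcb hc e).1 = e := rfl

/-- The graph of the zone port problem: the red bare adjacency. -/
@[simp] theorem rcPort_adj (u v : V) : (G.rcPort a b c O hca hcb hc).adj u v = G.BareAdj a b O u v := rfl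

/-- The root set of the zone port problem: the probe. -/
@[simp] theorem rcPort_root : (G.rcPort a b c O hca hcb hc).root = {c} := rfl

/-- The vertex of a terminal edge: its non-terminal end. -/
@[simp] theorem rcPort_tv (e : G.TE a b c O) : (G.rcPort a b c O hca hcb hc).tv e = G.tvOf a b e.1 := rfl

/-- The zone of a terminal edge: the port zone of its non-terminal end. -/
@[simp] theorem rcPort_tz (e : G.TE a b c O) :
    (G.rcPort a b c O hca hcb hc).tz e = G.portZone a b c O (G.tvOf a b e.1) := rfl

open Classical in
/-- The side of a terminal edge: whether it is at `b`. -/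
theorem rcPort_ts (e : G.TE a b c O) : (G.rcPort a b c O hca hcb hc).ts e = decide (G.EdgeAt e.1 b) := rfl

open Classical in
/-- Switchability of a zone: it contains a switchable vertex. -/
theorem rcPort_sw (C : Finset V) :
    (G.rcPort a b c O hca hcb hc).sw C = decide (∃ v ∈ C, G.Switchable a b c O v) := rfl

open Classical in
/-- The side of a term: `true` iff its edge joins its port vertex to `b`. -/
theorem ts_true_iff (hne : a ≠ b) (e : G.TE a b c O) :
    (G.rcPort a b c O hca hcb hc).ts e = true ↔ G.Joins e.1 (G.tvOf a b e.1) b := by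
  rw [rcPort_ts, decide_eq_true_iff]
  obtain ⟨hv, h⟩ := portVert_tvOf a b c O hca hcb e
  have hvt := portVert_ne_terminal a b c O hca hcb hv
  constructor
  · intro hb
    rcases h with h | h
    · exfalso
      rcases hb with hb | hb <;> rcases h with ⟨h1, h2⟩ | ⟨h1, h2⟩
      · exact hvt.2 (h1.symm.trans hb)
      · exact hne (h1.symm.trans hb)
      · exact hne (h2.symm.trans hb)
      · exact hvt.2 (h2.symm.trans hb)
    · exact h
  · intro h
    exact EdgeAt.of_joins_right h

/-- The side of a term: `false` iff its edge joins its port vertex to `a`. -/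
theorem ts_false_iff (hne : a ≠ b) (e : G.TE a b c O) :
    (G.rcPort a b c O hca hcb hc).ts e = false ↔ G.Joins e.1 (G.tvOf a b e.1) a := by
  obtain ⟨hv, h⟩ := portVert_tvOf a b c O hca hcb e
  have hvt := portVert_ne_terminal a b c O hca hcb hv
  constructor
  · intro hf
    rcases h with h | h
    · exact h
    · exfalso
      have : (G.rcPort a b c O hca hcb hc).ts e = true := (ts_true_iff hca hcb hc hne e).2 h
      rw [hf] at this
      exact Bool.noConfusion this
  · intro ha
    cases hs : (G.rcPort a b c O hca hcb hc).ts e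
    · rfl
    · exfalso
      have hb := (ts_true_iff hca hcb hc hne e).1 hs
      rcases ha with ⟨h1, h2⟩ | ⟨h1, h2⟩ <;> rcases hb with ⟨h3, h4⟩ | ⟨h3, h4⟩
      · exact hne (h2.symm.trans h4)
      · exact hvt.2 (h1.symm.trans h3)
      · exact hvt.2 (h2.symm.trans h4)
      · exact hne (h1.symm.trans h3)

open Classical in
/-- A zone is switchable iff it contains a switchable vertex. -/
theorem sw_true_iff (C : Finset V) :
    (G.rcPort a b c O hca hcb hc).sw C = true ↔ ∃ v ∈ C, G.Switchable a b c O v := by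
  rw [rcPort_sw, decide_eq_true_iff]

/-- The port vertices lie in `K`. -/
theorem PV_subset_bareReach : (G.rcPort a b c O hca hcb hc).PV ⊆ G.BareReach a b c O := by
  rintro v ⟨C, hC, hv⟩
  obtain ⟨w, hw, rfl⟩ := (mem_rcPort_Z_iff hca hcb hc).1 hC
  exact portZone_subset_bareReach a b c O hw.1 v hv

/-- **Every zone is reached from the probe**: its port vertex lies in `K`. -/
theorem rcPort_zonesReached : (G.rcPort a b c O hca hcb hc).ZonesReached := by
  intro C hC
  obtain ⟨w, hw, rfl⟩ := (mem_rcPort_Z_iff hca hcb hc).1 hC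
  exact ⟨c, Finset.mem_singleton_self c, w, self_mem_portZone a b c O w, hw.1⟩

/-- The pattern of a configuration: the colours of the terminal edges at the port vertices. -/
def rcPattern (S : Config E) : (G.rcPort a b c O hca hcb hc).Term → Bool := fun t => S t.1.1

/-- The pattern of a configuration, applied. -/
@[simp] theorem rcPattern_apply (S : Config E) (t : (G.rcPort a b c O hca hcb hc).Term) :
    rcPattern hca hcb hc S t = S t.1.1 := rfl

end Port

end MultiGraph

end PercRepro
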